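import Mathlib
import HarnessLib

/-!
# Route `KLProgramme` — engine / VL support, route (L2), FAT layer, WEIGHTED, SECTIONAL: scalar packaging for the closed-form sectional row

Cell `gate-hubbard-kl`, seat p3 (g11).  Pure real-arithmetic lemmas for `…AlphaWtSectionalClosed` (the fixed-time twin of `…AlphaWtClosed`):

* `fatCellCount_le` — the SPATIAL cell count of the fat multiplier in closed form (the space factor of `…AlphaFatScalars2.fatSupport_le`, without the
  time window): `(√2L(Λ_m + K_pρ_f²)/(γπ) + 2)(√2L·2ρ_f/π + 2) ≤ 16c₁c_ρ/(πγ) · L²Λ/N_r`;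
* `alphaProductWtSectional_le` — the final product: if `W ≤ C_W·N_r/Λ`, `N̄_cell ≤ C_N·L²Λ/N_r` and `N_t ≤ 16Λβ/π`, then
  `N_t·(√W·√(24·L²·N̄_cell)·((βL²)⁻²·4βL²/Λ)) ≤ (64/π)·√(24·C_W·C_N)` — free of `ε = β/(2M)`, of `Λ` and of `L`.

Everything is proved; no definitions. [folklore]
-/

noncomputable section

namespace Summit.HubbardSuperconductivity.HubbardSuperconductivity.Theorems.TorusFourierL2

set_option linter.dupNamespace false -- summit = problem name (single-conjunct summit), D-0017

/-- **The spatial cell count of the fat multiplier in closed form** (see the module docstring). [folklore] -/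
theorem fatCellCount_le {Λ Λm L γ Kp ρf cρ c₁ Nr : ℝ} (hΛ : 0 < Λ) (hL : 0 < L) (hγ : 0 < γ) (hNr : 0 < Nr)
    (hΛm : Λm = 4 * Λ) (hsh : Λm + Kp * ρf ^ 2 ≤ Λ * c₁) (hρfb : ρf ≤ cρ * Real.pi / Nr)
    (hKρ : 0 ≤ Kp * ρf ^ 2)
    (hY₁ : 2 ≤ Real.sqrt 2 * L * ((Λm + Kp * ρf ^ 2) / γ) / Real.pi) (hY₂ : 2 ≤ Real.sqrt 2 * L * (2 * ρf) / Real.pi) :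
    (Real.sqrt 2 * L * ((Λm + Kp * ρf ^ 2) / γ) / Real.pi + 2) * (Real.sqrt 2 * L * (2 * ρf) / Real.pi + 2) ≤
      16 * c₁ * cρ / (Real.pi * γ) * (L ^ 2 * Λ / Nr) := by
  have hπ0 := Real.pi_pos
  have hs2 : Real.sqrt 2 * Real.sqrt 2 = 2 := Real.mul_self_sqrt (by norm_num)
  have h2 : Real.sqrt 2 * L * ((Λm + Kp * ρf ^ 2) / γ) / Real.pi + 2 ≤ 2 * (Real.sqrt 2 * L * (Λ * c₁ / γ) / Real.pi) := by
    have : Real.sqrt 2 * L * ((Λm + Kp * ρf ^ 2) / γ) / Real.pi ≤ Real.sqrt 2 * L * (Λ * c₁ / γ) / Real.pi := by gcongr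
    linarith
  have h3 : Real.sqrt 2 * L * (2 * ρf) / Real.pi + 2 ≤ 2 * (Real.sqrt 2 * L * (2 * (cρ * Real.pi / Nr)) / Real.pi) := by
    have : Real.sqrt 2 * L * (2 * ρf) / Real.pi ≤ Real.sqrt 2 * L * (2 * (cρ * Real.pi / Nr)) / Real.pi := by gcongr
    linarith
  have h20 : 0 ≤ Real.sqrt 2 * L * ((Λm + Kp * ρf ^ 2) / γ) / Real.pi + 2 := by rw [hΛm]; positivity
  have h30 : 0 ≤ Real.sqrt 2 * L * (2 * ρf) / Real.pi + 2 := by linarith only [hY₂]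
  calc _ ≤ (2 * (Real.sqrt 2 * L * (Λ * c₁ / γ) / Real.pi)) * (2 * (Real.sqrt 2 * L * (2 * (cρ * Real.pi / Nr)) / Real.pi)) :=
        mul_le_mul h2 h3 h30 (h20.trans h2)
    _ = 16 * c₁ * cρ / (Real.pi * γ) * (L ^ 2 * Λ / Nr) := by
        have hs2sq : Real.sqrt 2 ^ 2 = 2 := by rw [pow_two]; exact hs2
        field_simp; ring_nf; rw [hs2sq]; ring

/-- **The final sectional product** (see the module docstring). [folklore] -/
theorem alphaProductWtSectional_le {W Nc CW CN Nt β L Λ Nr : ℝ} (hW0 : 0 ≤ W) (hNc0 : 0 ≤ Nc) (hCW : 0 ≤ CW) (hCN : 0 ≤ CN)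
    (hβ : 0 < β) (hL : 0 < L) (hΛ : 0 < Λ) (hNr : 0 < Nr) (hW : W ≤ CW * Nr / Λ) (hNc : Nc ≤ CN * (L ^ 2 * Λ / Nr))
    (hNt : Nt ≤ 16 * Λ * β / Real.pi) :
    Nt * (Real.sqrt W * Real.sqrt (24 * L ^ 2 * Nc) * ((1 / (β * L ^ 2)) ^ 2 * (4 * (β * L ^ 2) / Λ))) ≤
      64 / Real.pi * Real.sqrt (24 * CW * CN) := by
  have hπ0 := Real.pi_pos
  have h1 : Real.sqrt W * Real.sqrt (24 * L ^ 2 * Nc) = Real.sqrt (W * (24 * L ^ 2 * Nc)) := (Real.sqrt_mul hW0 _).symm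
  rw [h1]
  have h2 : W * (24 * L ^ 2 * Nc) ≤ (CW * Nr / Λ) * (24 * L ^ 2 * (CN * (L ^ 2 * Λ / Nr))) :=
    mul_le_mul hW (by gcongr) (by positivity) (by positivity)
  have h3 : (CW * Nr / Λ) * (24 * L ^ 2 * (CN * (L ^ 2 * Λ / Nr))) = (Real.sqrt (24 * CW * CN) * L ^ 2) ^ 2 := by
    rw [mul_pow, Real.sq_sqrt (by positivity)]; field_simp
  have h4 : Real.sqrt (W * (24 * L ^ 2 * Nc)) ≤ Real.sqrt (24 * CW * CN) * L ^ 2 := by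
    rw [← Real.sqrt_sq (by positivity : 0 ≤ Real.sqrt (24 * CW * CN) * L ^ 2), ← h3]
    exact Real.sqrt_le_sqrt h2
  have h5 : Real.sqrt (W * (24 * L ^ 2 * Nc)) * ((1 / (β * L ^ 2)) ^ 2 * (4 * (β * L ^ 2) / Λ)) ≤
      Real.sqrt (24 * CW * CN) * L ^ 2 * ((1 / (β * L ^ 2)) ^ 2 * (4 * (β * L ^ 2) / Λ)) :=
    mul_le_mul_of_nonneg_right h4 (by positivity)
  have e5 : Real.sqrt (24 * CW * CN) * L ^ 2 * ((1 / (β * L ^ 2)) ^ 2 * (4 * (β * L ^ 2) / Λ)) = 4 * Real.sqrt (24 * CW * CN) / (β * Λ) := by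
    field_simp
  rw [e5] at h5
  have h6 : 0 ≤ 4 * Real.sqrt (24 * CW * CN) / (β * Λ) := by positivity
  calc Nt * (Real.sqrt (W * (24 * L ^ 2 * Nc)) * ((1 / (β * L ^ 2)) ^ 2 * (4 * (β * L ^ 2) / Λ)))
      ≤ (16 * Λ * β / Real.pi) * (4 * Real.sqrt (24 * CW * CN) / (β * Λ)) := mul_le_mul hNt h5 (by positivity) (by positivity)
    _ = 64 / Real.pi * Real.sqrt (24 * CW * CN) := by field_simp; ring

end Summit.HubbardSuperconductivity.HubbardSuperconductivity.Theorems.TorusFourierL2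

end
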